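import Literature.NumberTheory.Automorphic.ArchTorusCoordinatesGL2
import Literature.NumberTheory.Automorphic.ArchKirillovODEGL2ComplexKType
import Literature.NumberTheory.Automorphic.ArchPlaceCasimirScalar
import Literature.NumberTheory.Automorphic.ArchWhittakerInfinitesimal
import HarnessLib

/-!
# The null space of the Kirillov map of `GL₂(K_∞)` is a `U(𝔤)`-submodule
# (Jacquet–Langlands (1970), §5–§6; Jacquet–Shalika (1981), §3)

Topic `NumberTheory/Automorphic`; namespace `Literature.NumberTheory.Automorphic`. One definition
(`kirillovNull`, a `Submodule`), theorems otherwise; no named fact, no instance.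

Let `τ` be a strongly continuous Banach representation of `G_∞ = GL₂(K_∞)` on `E`, `𝒢` its Gårding space,
`ℓ : 𝒢 → ℂ` a continuous `ψ_∞`-Whittaker functional (`IsArchContWhittakerFunctional`) and
`W_v(u) = ℓ(τ(diag(u,1)) v)` (`kirillovFn`) the Kirillov function of `v ∈ 𝒢` on `K_∞ˣ`. Put

  `S_ℓ = {v ∈ 𝒢 : W_v ≡ 0}`   (`kirillovNull hτ ℓ`).

This file proves that `S_ℓ` is a LINEAR SUBSPACE STABLE UNDER THE WHOLE INFINITESIMAL ACTION `τ(X)`,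
`X ∈ 𝔤𝔩₂(K_∞)` (`gardingEnd_mem_kirillovNull`), as soon as the centre `K_∞ · 1` of `𝔤` and the Casimir
elements of the real places and the holomorphic / antiholomorphic Casimir elements of the complex places act on
`𝒢` by scalars (which is the case for `τ` unitary and topologically irreducible: `ArchGardingSegal`,
`ArchPlaceCasimirScalar`; packaged in `gardingEnd_mem_kirillovNull_of_isUnitary`). The four root directions:

* `τ(diag(u', 1))` and hence `τ(E₀₀ ⊗ x)` preserve `S_ℓ` — `W_{τ(diag(u',1))v}(u) = W_v(u'u)`, and
  `ℓ(τ(diag(u,1)) τ(E₀₀ ⊗ x) v)` is the derivative at `0` of `s ↦ W_v(exp(sx) u) ≡ 0`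
  (`gardingAct_diagGL2_mem_kirillovNull`, `gardingEnd_single_zero_zero_mem_kirillovNull`);
* `τ(E₁₁ ⊗ x) = τ(x · 1) - τ(E₀₀ ⊗ x)` and `τ(x · 1)` is a scalar (`gardingEnd_single_one_one_mem_kirillovNull`);
* `τ(E₀₁ ⊗ x)`: `ℓ(τ(diag(u,1)) τ(E₀₁ ⊗ x) v) = dψ_∞(E₀₁ ⊗ ux) · W_v(u) = 0` (the infinitesimal Whittaker
  covariance `IsArchContWhittakerFunctional.apply_archDerivE_single`; `gardingEnd_single_zero_one_mem_kirillovNull`);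
* `τ(E₁₀ ⊗ x)` — THE CASIMIR TRICK: at a real place `w` the Casimir identity
  `λ v = τ(H₀)²v + τ(H₁)²v + 2 τ(X⁺)τ(X⁻) v - τ(H₀) v + τ(H₁) v` puts `τ(X⁺)(τ(X⁻) v)` in `S_ℓ` for `v ∈ S_ℓ`,
  whence `0 = ℓ(τ(diag(u,1)) τ(X⁺) τ(X⁻) v) = dψ_∞(E₀₁ ⊗ u_w r_w) · ℓ(τ(diag(u,1)) τ(X⁻) v)` with
  `dψ_∞(E₀₁ ⊗ u_w r_w) = -2πi u_w ≠ 0`; at a complex place the same with the holomorphic and the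
  antiholomorphic Casimir elements (`dψ^h = -4πi z_w`, `dψ^a = -4πi z̄_w`)
  (`gardingEnd_xMinus_mem_kirillovNull`, `gardingEndHol_one_zero_mem_kirillovNull`,
  `gardingEndAnti_one_zero_mem_kirillovNull`, `gardingEnd_single_one_zero_mem_kirillovNull`).

This is the device by which the tree's archimedean Kirillov ODE theory (`ArchKirillovODEGL2Real`, …,
`ArchKirillovStringBesselGL2Complex`), whose hypotheses "`τ(L) v = 0`", "`E x = 0`", … are only ever used
through `ℓ(τ(diag(·,1)) ·)`, is applied to vectors for which these relations are known only modulo `S_ℓ`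
(Jacquet–Langlands (1970), §5 Lemma 5.13.1 and §6: the Kirillov model is computed weight by weight).

## References

* H. Jacquet, R. P. Langlands, *Automorphic Forms on GL(2)*, LNM 114 (1970), §5 (Lemma 5.13.1, Thm. 5.15),
  §6 (Thm. 6.4). [JacquetLanglands1970]
* H. Jacquet, J. A. Shalika, *On Euler products and the classification of automorphic representations I*,
  Amer. J. Math. 103 (1981), §3 ((3.16): the Kirillov map). [JacquetShalikaAJM1981]
* A. W. Knapp, *Representation Theory of Semisimple Groups*, Princeton 1986, Ch. III §3, Ch. VIII §3. [Knapp1986]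
-/

noncomputable section

open MeasureTheory Measure NumberField NumberField.InfinitePlace NumberField.mixedEmbedding IsDedekindDomain Set Filter
open scoped MatrixGroups Topology Classical

namespace Literature.NumberTheory.Automorphic

variable {K : Type} [Field K] [NumberField K]

-- as in `ArchGardingWhittaker`
set_option backward.isDefEq.respectTransparency false

/-! ### 1. Matrix identities: `Ad(diag(u,1))` on the letters, units of `K_∞` -/

section Matrices

omit [NumberField K] in
/-- **`Ad(diag(u,1)) (E_{ij} ⊗ x) = E_{ij} ⊗ (d_i x d_j⁻¹)`**, `d = (u, 1)`: the four cases. [folklore] -/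
theorem diagGL2_conj_single (u : (mixedSpace K)ˣ) (x : mixedSpace K) :
    ((diagGL2 u 1 : GL (Fin 2) (mixedSpace K)) : Matrix (Fin 2) (Fin 2) (mixedSpace K)) * Matrix.single 0 0 x *
        (((diagGL2 u 1)⁻¹ : GL (Fin 2) (mixedSpace K)) : Matrix (Fin 2) (Fin 2) (mixedSpace K)) = Matrix.single 0 0 x ∧
    ((diagGL2 u 1 : GL (Fin 2) (mixedSpace K)) : Matrix (Fin 2) (Fin 2) (mixedSpace K)) * Matrix.single 1 1 x *
        (((diagGL2 u 1)⁻¹ : GL (Fin 2) (mixedSpace K)) : Matrix (Fin 2) (Fin 2) (mixedSpace K)) = Matrix.single 1 1 x ∧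
    ((diagGL2 u 1 : GL (Fin 2) (mixedSpace K)) : Matrix (Fin 2) (Fin 2) (mixedSpace K)) * Matrix.single 0 1 x *
        (((diagGL2 u 1)⁻¹ : GL (Fin 2) (mixedSpace K)) : Matrix (Fin 2) (Fin 2) (mixedSpace K)) =
      Matrix.single 0 1 ((u : mixedSpace K) * x) ∧
    ((diagGL2 u 1 : GL (Fin 2) (mixedSpace K)) : Matrix (Fin 2) (Fin 2) (mixedSpace K)) * Matrix.single 1 0 x *
        (((diagGL2 u 1)⁻¹ : GL (Fin 2) (mixedSpace K)) : Matrix (Fin 2) (Fin 2) (mixedSpace K)) =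
      Matrix.single 1 0 (((u⁻¹ : (mixedSpace K)ˣ) : mixedSpace K) * x) := by
  have hux : ∀ y : mixedSpace K, (u : mixedSpace K) * y * (u : mixedSpace K)⁻¹ = y := fun y => by
    rw [← Units.val_inv_eq_inv_val, mul_right_comm, Units.mul_inv, one_mul]
  have hux' : ∀ y : mixedSpace K, y * (u : mixedSpace K) * (u : mixedSpace K)⁻¹ = y := fun y => by
    rw [mul_comm y, hux]
  have hinv : ((u⁻¹ : (mixedSpace K)ˣ) : mixedSpace K) = (u : mixedSpace K)⁻¹ := Units.val_inv_eq_inv_val u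
  rw [diagGL2_one_inv, coe_diagGL2, coe_diagGL2, hinv]
  refine ⟨?_, ?_, ?_, ?_⟩ <;>
  · refine Matrix.ext fun i j => ?_
    fin_cases i <;> fin_cases j <;>
      simp [Matrix.mul_apply, Matrix.vecMul, dotProduct, Fin.sum_univ_two, Matrix.single_apply, hux, mul_comm x]

/-- Every `x ∈ K_∞` is the real combination `Σ_{w real} x_w r_w + Σ_{w complex} (Re x_w c_w + Im x_w ic_w)` of the
place idempotents. [folklore] -/
theorem mixedSpace_eq_sum (x : mixedSpace K) :
    x = ∑ w : {w : InfinitePlace K // IsReal w}, x.1 w • ((Pi.single w 1, 0) : mixedSpace K) +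
      ∑ w : {w : InfinitePlace K // IsComplex w}, ((x.2 w).re • ((0, Pi.single w 1) : mixedSpace K) +
        (x.2 w).im • ((0, Pi.single w Complex.I) : mixedSpace K)) := by
  refine Prod.ext ?_ ?_
  · simp only [Prod.fst_add, Prod.fst_sum, Prod.smul_fst, smul_zero, Finset.sum_const_zero, add_zero,
      Finset.sum_add_distrib]
    funext v
    simp [Finset.sum_apply, Pi.single_apply]
  · simp only [Prod.snd_add, Prod.snd_sum, Prod.smul_snd, smul_zero, Finset.sum_const_zero, zero_add,
      Finset.sum_add_distrib]
    funext v
    simp only [Pi.add_apply, Finset.sum_apply, Pi.smul_apply, Pi.single_apply, smul_ite,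
      Complex.real_smul, mul_one, smul_zero, Finset.sum_ite_eq, Finset.mem_univ, if_true]
    exact (Complex.re_add_im (x.2 v)).symm

/-- `Tr_{K_∞/ℝ}(u r_w) = u_w` for the real idempotent `r_w`. [folklore] -/
theorem mixedTrace_mul_realIdem (u : mixedSpace K) (w : {w : InfinitePlace K // IsReal w}) :
    mixedTrace K (u * ((Pi.single w 1, 0) : mixedSpace K)) = u.1 w := by
  rw [mixedTrace_apply]
  simp [Pi.single_apply, Finset.sum_ite_eq']

/-- `Tr_{K_∞/ℝ}(u c_w) = 2 Re u_w` for the complex idempotent `c_w`. [folklore] -/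
theorem mixedTrace_mul_complexIdem (u : mixedSpace K) (w : {w : InfinitePlace K // IsComplex w}) :
    mixedTrace K (u * ((0, Pi.single w 1) : mixedSpace K)) = 2 * (u.2 w).re := by
  rw [mixedTrace_apply]
  simp [Pi.single_apply, apply_ite Complex.re, mul_ite, Finset.sum_ite_eq']

/-- `Tr_{K_∞/ℝ}(u ic_w) = -2 Im u_w`. [folklore] -/
theorem mixedTrace_mul_complexIdemI (u : mixedSpace K) (w : {w : InfinitePlace K // IsComplex w}) :
    mixedTrace K (u * ((0, Pi.single w Complex.I) : mixedSpace K)) = -2 * (u.2 w).im := by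
  rw [mixedTrace_apply]
  simp [Pi.single_apply, apply_ite Complex.re, mul_ite, Finset.sum_ite_eq']

end Matrices

/-! ### 2. The null space `S_ℓ` of the Kirillov map -/

section Null

variable {hcpt : isCompact_glFiniteIntegralLevel 2 K}
  {E : Type*} [NormedAddCommGroup E] [NormedSpace ℂ E] [CompleteSpace E]
  {τ : ContRepresentation ℂ (AutomorphyDatum.gl 2 K hcpt).arch.carrier E}

/-- **The null space of the Kirillov map**: the Gårding vectors whose Kirillov function
`u ↦ ℓ(τ(diag(u,1)) v)` vanishes identically on `K_∞ˣ` (Jacquet–Langlands (1970), §5–§6, where it is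
`0` for an irreducible representation and its Whittaker functional; here for an arbitrary linear `ℓ`).
[cite: JacquetLanglands1970, §5 (Lemma 5.13.1)] -/
def kirillovNull (hτ : τ.IsStronglyContinuous) (ℓ : archGardingSpace hcpt τ →ₗ[ℂ] ℂ) :
    Submodule ℂ (archGardingSpace hcpt τ) where
  carrier := {v | ∀ u : (mixedSpace K)ˣ, kirillovFn hτ ℓ v u = 0}
  add_mem' {v v'} hv hv' u := by rw [kirillovFn_add, Pi.add_apply, hv u, hv' u, add_zero]
  zero_mem' u := by
    rw [kirillovFn_eq_apply_gardingAct, map_zero, map_zero]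
  smul_mem' c v hv u := by rw [kirillovFn_smul, Pi.smul_apply, hv u, smul_zero]

variable (hτ : τ.IsStronglyContinuous) (ℓ : archGardingSpace hcpt τ →ₗ[ℂ] ℂ)

/-- Membership in `S_ℓ`. [folklore] -/
theorem mem_kirillovNull_iff {v : archGardingSpace hcpt τ} :
    v ∈ kirillovNull hτ ℓ ↔ ∀ u : (mixedSpace K)ˣ, ℓ (gardingAct hτ (diagGL2 u 1) v) = 0 := Iff.rfl

/-- `S_ℓ` is stable under the torus `τ(diag(u',1))`: `W_{τ(diag(u',1))v}(u) = W_v(u'u)`. [folklore] -/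
theorem gardingAct_diagGL2_mem_kirillovNull (u' : (mixedSpace K)ˣ) {v : archGardingSpace hcpt τ}
    (hv : v ∈ kirillovNull hτ ℓ) : gardingAct hτ (diagGL2 u' 1) v ∈ kirillovNull hτ ℓ := by
  intro u
  have h := hv (u' * u)
  rwa [kirillovFn_mul] at h

/-- `S_ℓ` is stable under any `τ(g)` with `g = diag(u', 1)` (e.g. the sign `δ_w`). [folklore] -/
theorem gardingAct_mem_kirillovNull_of_eq_diagGL2 {g : GL (Fin 2) (mixedSpace K)} {u' : (mixedSpace K)ˣ}
    (hg : g = diagGL2 u' 1) {v : archGardingSpace hcpt τ} (hv : v ∈ kirillovNull hτ ℓ) :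
    gardingAct hτ g v ∈ kirillovNull hτ ℓ := by
  rw [hg]; exact gardingAct_diagGL2_mem_kirillovNull hτ ℓ u' hv

/-- A vector with a non-vanishing Kirillov value is not in `S_ℓ`. [folklore] -/
theorem not_mem_kirillovNull_of_ne_zero {v : archGardingSpace hcpt τ} {u : (mixedSpace K)ˣ}
    (h : ℓ (gardingAct hτ (diagGL2 u 1) v) ≠ 0) : v ∉ kirillovNull hτ ℓ := fun hv => h (hv u)

/-- `ℓ` vanishes on `S_ℓ` (`u = 1`). [folklore] -/
theorem apply_eq_zero_of_mem_kirillovNull {v : archGardingSpace hcpt τ} (hv : v ∈ kirillovNull hτ ℓ) : ℓ v = 0 := by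
  have h := hv 1
  rw [kirillovFn_eq_apply_gardingAct] at h
  have e : (diagGL2 (1 : (mixedSpace K)ˣ) 1 : GL (Fin 2) (mixedSpace K)) = 1 := by
    refine Units.ext ?_
    rw [coe_diagGL2_one]; simp
  rwa [e, gardingAct_one, Module.End.one_apply] at h

end Null

/-! ### 3. Stability under `τ(E₀₀ ⊗ x)`, `τ(E₁₁ ⊗ x)`, `τ(E₀₁ ⊗ x)` -/

section Borel

variable {hcpt : isCompact_glFiniteIntegralLevel 2 K}
  {E : Type*} [NormedAddCommGroup E] [NormedSpace ℂ E] [CompleteSpace E]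
  {τ : ContRepresentation ℂ (AutomorphyDatum.gl 2 K hcpt).arch.carrier E}
  (hτ : τ.IsStronglyContinuous) {ℓ : archGardingSpace hcpt τ →ₗ[ℂ] ℂ}

local notation "D" => gardingEnd (hcpt := hcpt) (τ := τ) hτ

/-- **Derivative device.** If `s ↦ expGL(s X)` stays in the torus `{diag(u,1)}` then `τ(X)` preserves
`S_ℓ`: `ℓ(τ(diag(u,1)) τ(X) v) = ℓ(τ(X)(τ(diag(u,1)) v))` (`Ad(diag) X = X`) is the derivative at `s = 0` of
`s ↦ W_v(exp(sX) · u) ≡ 0`. [folklore] -/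
theorem gardingEnd_mem_kirillovNull_of_expGL_eq_diagGL2
    (hℓ : ∃ (C : ℝ) (𝒮 : Finset (List (Matrix (Fin 2) (Fin 2) (mixedSpace K)))), 0 ≤ C ∧
      ∀ v : archGardingSpace hcpt τ, ‖ℓ v‖ ≤ C * ∑ w ∈ 𝒮, ‖archWordDerivE hcpt τ w v‖)
    {X : Matrix (Fin 2) (Fin 2) (mixedSpace K)}
    (hX : ∀ s : ℝ, ∃ u' : (mixedSpace K)ˣ, expGL (s • X) = (diagGL2 u' 1 : GL (Fin 2) (mixedSpace K)))
    (hconj : ∀ u : (mixedSpace K)ˣ, ((diagGL2 u 1 : GL (Fin 2) (mixedSpace K)) : Matrix (Fin 2) (Fin 2) (mixedSpace K)) * X *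
        (((diagGL2 u 1)⁻¹ : GL (Fin 2) (mixedSpace K)) : Matrix (Fin 2) (Fin 2) (mixedSpace K)) = X)
    {v : archGardingSpace hcpt τ} (hv : v ∈ kirillovNull hτ ℓ) : D X v ∈ kirillovNull hτ ℓ := by
  intro u
  rw [kirillovFn_eq_apply_gardingAct, ← Module.End.mul_apply, gardingAct_mul_gardingEnd hτ, hconj u, Module.End.mul_apply]
  -- the derivative at `0` of the identically vanishing function `s ↦ W_v(exp(sX) u)`
  set y : archGardingSpace hcpt τ := gardingAct hτ (diagGL2 u 1) v with hy
  have hd := hasDerivAt_apply_expGL_of_normLe (hcpt := hcpt) (τ := τ) hτ hℓ X y.2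
  have hzero : (fun s : ℝ => ℓ ⟨τ (toArch hcpt (expGL (s • X))) (y : E), apply_mem_archGardingSpace hτ _ y.2⟩) = fun _ => 0 := by
    funext s
    obtain ⟨u', hu'⟩ := hX s
    have h := hv (u * u')
    rw [kirillovFn_mul] at h
    rw [← h, hu']
    rfl
  rw [hzero] at hd
  have h0 := hd.unique (hasDerivAt_const (0 : ℝ) (0 : ℂ))
  rw [← h0]
  rfl

/-- `expGL(s E₀₀ ⊗ r_w) = diag(e^s at w, 1)`. [folklore] -/
theorem exists_expGL_smul_hZero_eq_diagGL2 (w : {w : InfinitePlace K // IsReal w}) (s : ℝ) :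
    ∃ u' : (mixedSpace K)ˣ, expGL (s • Matrix.single (0 : Fin 2) (0 : Fin 2) ((Pi.single w 1, 0) : mixedSpace K)) =
      (diagGL2 u' 1 : GL (Fin 2) (mixedSpace K)) := by
  refine ⟨realUnitAt K w (Units.mk0 (Real.exp s) (Real.exp_pos s).ne'), ?_⟩
  rw [diagGL2_realUnitAt_of_pos w (by exact Real.exp_pos s)]
  simp [Real.log_exp]

/-- `expGL(s E₀₀ ⊗ c_w) = diag(e^s at w, 1)`. [folklore] -/
theorem exists_expGL_smul_hZeroC_eq_diagGL2 (w : {w : InfinitePlace K // IsComplex w}) (s : ℝ) :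
    ∃ u' : (mixedSpace K)ˣ, expGL (s • Matrix.single (0 : Fin 2) (0 : Fin 2) ((0, Pi.single w 1) : mixedSpace K)) =
      (diagGL2 u' 1 : GL (Fin 2) (mixedSpace K)) := by
  refine ⟨complexUnitAt K w (Units.mk0 ((Real.exp s : ℝ) : ℂ) (by exact_mod_cast (Real.exp_pos s).ne')), ?_⟩
  rw [diagGL2_complexUnitAt]
  have h1 : Real.log ‖(((Units.mk0 ((Real.exp s : ℝ) : ℂ) (by exact_mod_cast (Real.exp_pos s).ne')) : ℂˣ) : ℂ)‖ = s := by
    rw [Units.val_mk0, Complex.norm_real, Real.norm_eq_abs, abs_of_pos (Real.exp_pos s), Real.log_exp]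
  have h2 : Complex.arg (((Units.mk0 ((Real.exp s : ℝ) : ℂ) (by exact_mod_cast (Real.exp_pos s).ne')) : ℂˣ) : ℂ) = 0 := by
    rw [Units.val_mk0]; exact Complex.arg_ofReal_of_nonneg (Real.exp_pos s).le
  rw [h1, h2, zero_smul, expGL_zero, mul_one]

/-- `expGL(s E₀₀ ⊗ ic_w) = diag(e^{is} at w, 1)`. [folklore] -/
theorem exists_expGL_smul_single_complexIdemI_eq_diagGL2 (w : {w : InfinitePlace K // IsComplex w}) (s : ℝ) :
    ∃ u' : (mixedSpace K)ˣ, expGL (s • Matrix.single (0 : Fin 2) (0 : Fin 2) ((0, Pi.single w Complex.I) : mixedSpace K)) =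
      (diagGL2 u' 1 : GL (Fin 2) (mixedSpace K)) := by
  refine ⟨complexUnitAt K w (Units.mk0 (Complex.exp (s * Complex.I)) (Complex.exp_ne_zero _)), ?_⟩
  refine Units.ext ?_
  rw [coe_expGL_smul_single_complexIdemI, coe_diagGL2_one, coe_complexUnitAt_sub_one]
  rfl

/-- **`τ(E₀₀ ⊗ x)` preserves `S_ℓ`** for every `x ∈ K_∞`. [cite: JacquetLanglands1970, §5 (Lemma 5.13.1)] -/
theorem gardingEnd_single_zero_zero_mem_kirillovNull
    (hℓ : ∃ (C : ℝ) (𝒮 : Finset (List (Matrix (Fin 2) (Fin 2) (mixedSpace K)))), 0 ≤ C ∧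
      ∀ v : archGardingSpace hcpt τ, ‖ℓ v‖ ≤ C * ∑ w ∈ 𝒮, ‖archWordDerivE hcpt τ w v‖)
    (x : mixedSpace K) {v : archGardingSpace hcpt τ} (hv : v ∈ kirillovNull hτ ℓ) :
    D (Matrix.single 0 0 x) v ∈ kirillovNull hτ ℓ := by
  have hx : Matrix.single (0 : Fin 2) (0 : Fin 2) x =
      ∑ w : {w : InfinitePlace K // IsReal w}, x.1 w • Matrix.single (0 : Fin 2) (0 : Fin 2) ((Pi.single w 1, 0) : mixedSpace K) +
        ∑ w : {w : InfinitePlace K // IsComplex w},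
          ((x.2 w).re • Matrix.single (0 : Fin 2) (0 : Fin 2) ((0, Pi.single w 1) : mixedSpace K) +
            (x.2 w).im • Matrix.single (0 : Fin 2) (0 : Fin 2) ((0, Pi.single w Complex.I) : mixedSpace K)) := by
    have e : ∀ y : mixedSpace K, Matrix.single (0 : Fin 2) (0 : Fin 2) y = Matrix.singleLinearMap ℝ (0 : Fin 2) (0 : Fin 2) y :=
      fun y => rfl
    conv_lhs => rw [e, mixedSpace_eq_sum x]
    simp only [map_add, _root_.map_sum, map_smul]
    rfl
  rw [hx, gardingEnd_add, gardingEnd_sum_smul, gardingEnd_sum, LinearMap.add_apply, LinearMap.sum_apply,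
    LinearMap.sum_apply]
  refine Submodule.add_mem _ (Submodule.sum_mem _ fun w _ => ?_) (Submodule.sum_mem _ fun w _ => ?_)
  · rw [LinearMap.smul_apply]
    exact Submodule.smul_mem _ _ (gardingEnd_mem_kirillovNull_of_expGL_eq_diagGL2 hτ hℓ
      (exists_expGL_smul_hZero_eq_diagGL2 w) (fun u => (diagGL2_conj_single u _).1) hv)
  · rw [gardingEnd_add, gardingEnd_smul, gardingEnd_smul, LinearMap.add_apply, LinearMap.smul_apply, LinearMap.smul_apply]
    exact Submodule.add_mem _
      (Submodule.smul_mem _ _ (gardingEnd_mem_kirillovNull_of_expGL_eq_diagGL2 hτ hℓ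
        (exists_expGL_smul_hZeroC_eq_diagGL2 w) (fun u => (diagGL2_conj_single u _).1) hv))
      (Submodule.smul_mem _ _ (gardingEnd_mem_kirillovNull_of_expGL_eq_diagGL2 hτ hℓ
        (exists_expGL_smul_single_complexIdemI_eq_diagGL2 w) (fun u => (diagGL2_conj_single u _).1) hv))

/-- **`τ(E₁₁ ⊗ x)` preserves `S_ℓ`** if the central direction `x · 1` acts on `𝒢` by a scalar:
`E₁₁ ⊗ x = x · 1 - E₀₀ ⊗ x`. [cite: JacquetLanglands1970, §5 (Lemma 5.13.1)] -/
theorem gardingEnd_single_one_one_mem_kirillovNull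
    (hℓ : ∃ (C : ℝ) (𝒮 : Finset (List (Matrix (Fin 2) (Fin 2) (mixedSpace K)))), 0 ≤ C ∧
      ∀ v : archGardingSpace hcpt τ, ‖ℓ v‖ ≤ C * ∑ w ∈ 𝒮, ‖archWordDerivE hcpt τ w v‖)
    (x : mixedSpace K) (hcen : ∃ d : ℂ, ∀ v : archGardingSpace hcpt τ, D (x • (1 : Matrix (Fin 2) (Fin 2) (mixedSpace K))) v = d • v)
    {v : archGardingSpace hcpt τ} (hv : v ∈ kirillovNull hτ ℓ) :
    D (Matrix.single 1 1 x) v ∈ kirillovNull hτ ℓ := by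
  have e : Matrix.single (1 : Fin 2) (1 : Fin 2) x = x • (1 : Matrix (Fin 2) (Fin 2) (mixedSpace K)) - Matrix.single 0 0 x := by
    rw [eq_sub_iff_add_eq]
    refine Matrix.ext fun i j => ?_
    fin_cases i <;> fin_cases j <;> simp
  obtain ⟨d, hd⟩ := hcen
  rw [e, gardingEnd_sub, LinearMap.sub_apply, hd]
  exact Submodule.sub_mem _ (Submodule.smul_mem _ _ hv) (gardingEnd_single_zero_zero_mem_kirillovNull hτ hℓ x hv)

/-- **`τ(E₀₁ ⊗ x)` preserves `S_ℓ`** for a continuous `ψ_∞`-Whittaker functional: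
`ℓ(τ(diag(u,1)) τ(E₀₁ ⊗ x) v) = dψ_∞(E₀₁ ⊗ ux) ℓ(τ(diag(u,1)) v)`. [cite: JacquetLanglands1970, §5 (Lemma 5.13.1)] -/
theorem apply_gardingAct_diagGL2_gardingEnd_single_zero_one (hℓW : IsArchContWhittakerFunctional hcpt τ hτ ℓ)
    (x : mixedSpace K) (u : (mixedSpace K)ˣ) (v : archGardingSpace hcpt τ) :
    ℓ (gardingAct hτ (diagGL2 u 1) (D (Matrix.single 0 1 x) v)) =
      archWhittakerDChar K (0 : Fin 2) 1 ((u : mixedSpace K) * x) * ℓ (gardingAct hτ (diagGL2 u 1) v) := by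
  rw [← Module.End.mul_apply, gardingAct_mul_gardingEnd hτ, (diagGL2_conj_single u x).2.2.1, Module.End.mul_apply]
  exact hℓW.apply_archDerivE_single (by decide) _ (gardingAct hτ (diagGL2 u 1) v).2

/-- `τ(E₀₁ ⊗ x)` preserves `S_ℓ`. [cite: JacquetLanglands1970, §5 (Lemma 5.13.1)] -/
theorem gardingEnd_single_zero_one_mem_kirillovNull (hℓW : IsArchContWhittakerFunctional hcpt τ hτ ℓ)
    (x : mixedSpace K) {v : archGardingSpace hcpt τ} (hv : v ∈ kirillovNull hτ ℓ) :
    D (Matrix.single 0 1 x) v ∈ kirillovNull hτ ℓ := by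
  intro u
  have h := hv u
  rw [kirillovFn_eq_apply_gardingAct] at h
  rw [kirillovFn_eq_apply_gardingAct, apply_gardingAct_diagGL2_gardingEnd_single_zero_one hτ hℓW, h, mul_zero]

/-- The infinitesimal character on `E₀₁ ⊗ u r_w`: `dψ_∞ = -2πi u_w`, non-zero. [folklore] -/
theorem archWhittakerDChar_mul_realIdem (u : (mixedSpace K)ˣ) (w : {w : InfinitePlace K // IsReal w}) :
    archWhittakerDChar K (0 : Fin 2) 1 ((u : mixedSpace K) * ((Pi.single w 1, 0) : mixedSpace K)) =
      ((-(2 * Real.pi) * (u : mixedSpace K).1 w : ℝ) : ℂ) * Complex.I ∧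
    archWhittakerDChar K (0 : Fin 2) 1 ((u : mixedSpace K) * ((Pi.single w 1, 0) : mixedSpace K)) ≠ 0 := by
  have h : archWhittakerDChar K (0 : Fin 2) 1 ((u : mixedSpace K) * ((Pi.single w 1, 0) : mixedSpace K)) =
      ((-(2 * Real.pi) * (u : mixedSpace K).1 w : ℝ) : ℂ) * Complex.I := by
    rw [archWhittakerDChar, if_pos (by decide), mixedTrace_mul_realIdem]
  refine ⟨h, ?_⟩
  rw [h]
  refine mul_ne_zero ?_ Complex.I_ne_zero
  exact_mod_cast mul_ne_zero (neg_ne_zero.2 (mul_ne_zero two_ne_zero Real.pi_pos.ne')) (units_fst_ne_zero u w)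

/-- The holomorphic infinitesimal character on `E₀₁ ⊗ u c_w`: `dψ^h = dψ(uc) - i dψ(u ic) = -4πi z_w ≠ 0`. [folklore] -/
theorem archWhittakerDChar_hol (u : (mixedSpace K)ˣ) (w : {w : InfinitePlace K // IsComplex w}) :
    archWhittakerDChar K (0 : Fin 2) 1 ((u : mixedSpace K) * ((0, Pi.single w 1) : mixedSpace K)) -
        Complex.I * archWhittakerDChar K (0 : Fin 2) 1 ((u : mixedSpace K) * ((0, Pi.single w Complex.I) : mixedSpace K)) =
      -(4 * Real.pi) * Complex.I * (u : mixedSpace K).2 w ∧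
    archWhittakerDChar K (0 : Fin 2) 1 ((u : mixedSpace K) * ((0, Pi.single w 1) : mixedSpace K)) -
        Complex.I * archWhittakerDChar K (0 : Fin 2) 1 ((u : mixedSpace K) * ((0, Pi.single w Complex.I) : mixedSpace K)) ≠ 0 := by
  have h : archWhittakerDChar K (0 : Fin 2) 1 ((u : mixedSpace K) * ((0, Pi.single w 1) : mixedSpace K)) -
        Complex.I * archWhittakerDChar K (0 : Fin 2) 1 ((u : mixedSpace K) * ((0, Pi.single w Complex.I) : mixedSpace K)) =
      -(4 * Real.pi) * Complex.I * (u : mixedSpace K).2 w := by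
    rw [archWhittakerDChar, if_pos (by decide), archWhittakerDChar, if_pos (by decide), mixedTrace_mul_complexIdem,
      mixedTrace_mul_complexIdemI]
    conv_rhs => rw [← Complex.re_add_im ((u : mixedSpace K).2 w)]
    push_cast
    ring
  refine ⟨h, ?_⟩
  rw [h]
  refine mul_ne_zero (mul_ne_zero ?_ Complex.I_ne_zero) (units_snd_ne_zero u w)
  exact neg_ne_zero.2 (mul_ne_zero (by norm_num) (by exact_mod_cast Real.pi_pos.ne'))

/-- `conj z = Re z - i Im z`. [folklore] -/
theorem conj_eq_re_sub_im (z : ℂ) : (starRingEnd ℂ) z = (z.re : ℂ) - z.im * Complex.I :=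
  Complex.ext (by simp) (by simp)

/-- The antiholomorphic infinitesimal character: `dψ^a = dψ(uc) + i dψ(u ic) = -4πi z̄_w ≠ 0`. [folklore] -/
theorem archWhittakerDChar_anti (u : (mixedSpace K)ˣ) (w : {w : InfinitePlace K // IsComplex w}) :
    archWhittakerDChar K (0 : Fin 2) 1 ((u : mixedSpace K) * ((0, Pi.single w 1) : mixedSpace K)) +
        Complex.I * archWhittakerDChar K (0 : Fin 2) 1 ((u : mixedSpace K) * ((0, Pi.single w Complex.I) : mixedSpace K)) =
      -(4 * Real.pi) * Complex.I * (starRingEnd ℂ) ((u : mixedSpace K).2 w) ∧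
    archWhittakerDChar K (0 : Fin 2) 1 ((u : mixedSpace K) * ((0, Pi.single w 1) : mixedSpace K)) +
        Complex.I * archWhittakerDChar K (0 : Fin 2) 1 ((u : mixedSpace K) * ((0, Pi.single w Complex.I) : mixedSpace K)) ≠ 0 := by
  have h : archWhittakerDChar K (0 : Fin 2) 1 ((u : mixedSpace K) * ((0, Pi.single w 1) : mixedSpace K)) +
        Complex.I * archWhittakerDChar K (0 : Fin 2) 1 ((u : mixedSpace K) * ((0, Pi.single w Complex.I) : mixedSpace K)) =
      -(4 * Real.pi) * Complex.I * (starRingEnd ℂ) ((u : mixedSpace K).2 w) := by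
    rw [archWhittakerDChar, if_pos (by decide), archWhittakerDChar, if_pos (by decide), mixedTrace_mul_complexIdem,
      mixedTrace_mul_complexIdemI, conj_eq_re_sub_im]
    push_cast
    ring
  refine ⟨h, ?_⟩
  rw [h]
  refine mul_ne_zero (mul_ne_zero ?_ Complex.I_ne_zero) ((map_ne_zero _).2 (units_snd_ne_zero u w))
  exact neg_ne_zero.2 (mul_ne_zero (by norm_num) (by exact_mod_cast Real.pi_pos.ne'))

end Borel

/-! ### 4. Stability under `τ(E₁₀ ⊗ x)`: the Casimir trick -/

section Casimir

variable {hcpt : isCompact_glFiniteIntegralLevel 2 K}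
  {E : Type*} [NormedAddCommGroup E] [NormedSpace ℂ E] [CompleteSpace E]
  {τ : ContRepresentation ℂ (AutomorphyDatum.gl 2 K hcpt).arch.carrier E}
  (hτ : τ.IsStronglyContinuous) {ℓ : archGardingSpace hcpt τ →ₗ[ℂ] ℂ}

local notation "D" => gardingEnd (hcpt := hcpt) (τ := τ) hτ

/-- **The Casimir trick at a real place**: if the centre and the Casimir element of the real place `w` act on
`𝒢` by scalars, `τ(X⁻_w) = τ(E₁₀ ⊗ r_w)` preserves `S_ℓ`. [cite: JacquetLanglands1970, §5 (Lemma 5.13.1)] -/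
theorem gardingEnd_xMinus_mem_kirillovNull (hℓW : IsArchContWhittakerFunctional hcpt τ hτ ℓ)
    (w : {w : InfinitePlace K // IsReal w})
    (hcen : ∀ x : mixedSpace K, ∃ d : ℂ, ∀ v : archGardingSpace hcpt τ, D (x • (1 : Matrix (Fin 2) (Fin 2) (mixedSpace K))) v = d • v)
    (hcas : ∃ c : ℂ, ∀ v : archGardingSpace hcpt τ,
      ∑ i : Fin 2, ∑ j : Fin 2, D (Matrix.single i j ((Pi.single w 1, 0) : mixedSpace K))
        (D (Matrix.single j i ((Pi.single w 1, 0) : mixedSpace K)) v) = c • v)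
    {v : archGardingSpace hcpt τ} (hv : v ∈ kirillovNull hτ ℓ) :
    D (Matrix.single 1 0 ((Pi.single w 1, 0) : mixedSpace K)) v ∈ kirillovNull hτ ℓ := by
  obtain ⟨c, hc⟩ := hcas
  set H₀ := Matrix.single (0 : Fin 2) (0 : Fin 2) ((Pi.single w 1, 0) : mixedSpace K) with hH₀
  set H₁ := Matrix.single (1 : Fin 2) (1 : Fin 2) ((Pi.single w 1, 0) : mixedSpace K) with hH₁
  set Xp := Matrix.single (0 : Fin 2) (1 : Fin 2) ((Pi.single w 1, 0) : mixedSpace K) with hXp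
  set Xm := Matrix.single (1 : Fin 2) (0 : Fin 2) ((Pi.single w 1, 0) : mixedSpace K) with hXm
  -- the Casimir identity on `v`
  have h := hc v
  rw [Fin.sum_univ_two, Fin.sum_univ_two, Fin.sum_univ_two] at h
  have hcomm : D Xm (D Xp v) = D Xp (D Xm v) - D H₀ v + D H₁ v := by
    have h' := congrArg (fun T => T v) (gardingEnd_xPlus_mul_xMinus hτ w)
    simp only [Module.End.mul_apply, LinearMap.add_apply, LinearMap.sub_apply] at h'
    rw [← hH₀, ← hH₁, ← hXp, ← hXm] at h'
    rw [h']; abel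
  have h2 : (2 : ℂ) • D Xp (D Xm v) = c • v - D H₀ (D H₀ v) - D H₁ (D H₁ v) + D H₀ v - D H₁ v := by
    rw [two_smul, ← h, hcomm]; abel
  have h3 : D Xp (D Xm v) = (2 : ℂ)⁻¹ • (c • v - D H₀ (D H₀ v) - D H₁ (D H₁ v) + D H₀ v - D H₁ v) := by
    rw [← h2, smul_smul, inv_mul_cancel₀ (two_ne_zero' ℂ), one_smul]
  have hH₀m : ∀ y : archGardingSpace hcpt τ, y ∈ kirillovNull hτ ℓ → D H₀ y ∈ kirillovNull hτ ℓ :=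
    fun y hy => gardingEnd_single_zero_zero_mem_kirillovNull hτ hℓW.norm_le _ hy
  have hH₁m : ∀ y : archGardingSpace hcpt τ, y ∈ kirillovNull hτ ℓ → D H₁ y ∈ kirillovNull hτ ℓ :=
    fun y hy => gardingEnd_single_one_one_mem_kirillovNull hτ hℓW.norm_le _ (hcen _) hy
  have key : D Xp (D Xm v) ∈ kirillovNull hτ ℓ := by
    rw [h3]
    refine Submodule.smul_mem _ _ (Submodule.sub_mem _ (Submodule.add_mem _ (Submodule.sub_mem _ (Submodule.sub_mem _
      (Submodule.smul_mem _ _ hv) (hH₀m _ (hH₀m _ hv))) (hH₁m _ (hH₁m _ hv))) (hH₀m _ hv)) (hH₁m _ hv))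
  -- divide by the non-vanishing infinitesimal character
  intro u
  have hk := key u
  rw [kirillovFn_eq_apply_gardingAct, hXp, apply_gardingAct_diagGL2_gardingEnd_single_zero_one hτ hℓW] at hk
  rw [kirillovFn_eq_apply_gardingAct]
  exact (mul_eq_zero.1 hk).resolve_left (archWhittakerDChar_mul_realIdem u w).2

variable (w : {w : InfinitePlace K // IsComplex w})

local notation "𝐜" => ((0, Pi.single w 1) : mixedSpace K)
local notation "𝐜I" => ((0, Pi.single w Complex.I) : mixedSpace K)
local notation "Dh[" i "," j "]" => (gardingEnd (hcpt := hcpt) (τ := τ) hτ (Matrix.single (i : Fin 2) (j : Fin 2) ((0, Pi.single w 1) : mixedSpace K)) -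
  Complex.I • gardingEnd (hcpt := hcpt) (τ := τ) hτ (Matrix.single (i : Fin 2) (j : Fin 2) ((0, Pi.single w Complex.I) : mixedSpace K)))
local notation "Da[" i "," j "]" => (gardingEnd (hcpt := hcpt) (τ := τ) hτ (Matrix.single (i : Fin 2) (j : Fin 2) ((0, Pi.single w 1) : mixedSpace K)) +
  Complex.I • gardingEnd (hcpt := hcpt) (τ := τ) hτ (Matrix.single (i : Fin 2) (j : Fin 2) ((0, Pi.single w Complex.I) : mixedSpace K)))

/-- The diagonal holomorphic / antiholomorphic letters preserve `S_ℓ`. [folklore] -/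
theorem gardingEnd_sub_smul_mem_kirillovNull
    (hℓ : ∃ (C : ℝ) (𝒮 : Finset (List (Matrix (Fin 2) (Fin 2) (mixedSpace K)))), 0 ≤ C ∧
      ∀ v : archGardingSpace hcpt τ, ‖ℓ v‖ ≤ C * ∑ w ∈ 𝒮, ‖archWordDerivE hcpt τ w v‖)
    (hcen : ∀ x : mixedSpace K, ∃ d : ℂ, ∀ v : archGardingSpace hcpt τ, D (x • (1 : Matrix (Fin 2) (Fin 2) (mixedSpace K))) v = d • v)
    (i : Fin 2) (s : ℂ) {v : archGardingSpace hcpt τ} (hv : v ∈ kirillovNull hτ ℓ) :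
    (D (Matrix.single i i 𝐜) + s • D (Matrix.single i i 𝐜I)) v ∈ kirillovNull hτ ℓ := by
  rw [LinearMap.add_apply, LinearMap.smul_apply]
  fin_cases i
  · exact Submodule.add_mem _ (gardingEnd_single_zero_zero_mem_kirillovNull hτ hℓ _ hv)
      (Submodule.smul_mem _ _ (gardingEnd_single_zero_zero_mem_kirillovNull hτ hℓ _ hv))
  · exact Submodule.add_mem _ (gardingEnd_single_one_one_mem_kirillovNull hτ hℓ _ (hcen _) hv)
      (Submodule.smul_mem _ _ (gardingEnd_single_one_one_mem_kirillovNull hτ hℓ _ (hcen _) hv))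

/-- `ℓ(τ(diag(u,1)) (τ(E₀₁ ⊗ c) + s τ(E₀₁ ⊗ ic)) y) = (dψ(uc) + s dψ(u ic)) ℓ(τ(diag(u,1)) y)`. [folklore] -/
theorem apply_gardingAct_diagGL2_gardingEnd_zero_one_add_smul (hℓW : IsArchContWhittakerFunctional hcpt τ hτ ℓ)
    (s : ℂ) (u : (mixedSpace K)ˣ) (y : archGardingSpace hcpt τ) :
    ℓ (gardingAct hτ (diagGL2 u 1) ((D (Matrix.single 0 1 𝐜) + s • D (Matrix.single 0 1 𝐜I)) y)) =
      (archWhittakerDChar K (0 : Fin 2) 1 ((u : mixedSpace K) * 𝐜) +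
        s * archWhittakerDChar K (0 : Fin 2) 1 ((u : mixedSpace K) * 𝐜I)) * ℓ (gardingAct hτ (diagGL2 u 1) y) := by
  rw [LinearMap.add_apply, LinearMap.smul_apply, map_add, map_smul, map_add, map_smul,
    apply_gardingAct_diagGL2_gardingEnd_single_zero_one hτ hℓW, apply_gardingAct_diagGL2_gardingEnd_single_zero_one hτ hℓW,
    smul_eq_mul]
  ring

/-- **The Casimir trick at a complex place, holomorphic / antiholomorphic letters** (`s = -i`, `s = i`): if the
centre and the Casimir element `Σ τ^s(E_{ij}) τ^s(E_{ji})` (`τ^s(E_{ij}) = τ(E_{ij} ⊗ c) + s τ(E_{ij} ⊗ ic)`) act by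
scalars and `dψ(uc) + s dψ(u ic) ≠ 0` for all units `u`, then `τ^s(E₁₀)` preserves `S_ℓ`.
[cite: JacquetLanglands1970, §6 (Thm. 6.4)] -/
theorem gardingEnd_one_zero_add_smul_mem_kirillovNull (hℓW : IsArchContWhittakerFunctional hcpt τ hτ ℓ)
    (hcen : ∀ x : mixedSpace K, ∃ d : ℂ, ∀ v : archGardingSpace hcpt τ, D (x • (1 : Matrix (Fin 2) (Fin 2) (mixedSpace K))) v = d • v)
    (s : ℂ)
    (hcomm : (D (Matrix.single 0 1 𝐜) + s • D (Matrix.single 0 1 𝐜I)) * (D (Matrix.single 1 0 𝐜) + s • D (Matrix.single 1 0 𝐜I)) -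
        (D (Matrix.single 1 0 𝐜) + s • D (Matrix.single 1 0 𝐜I)) * (D (Matrix.single 0 1 𝐜) + s • D (Matrix.single 0 1 𝐜I)) =
      (2 : ℂ) • ((D (Matrix.single 0 0 𝐜) + s • D (Matrix.single 0 0 𝐜I)) - (D (Matrix.single 1 1 𝐜) + s • D (Matrix.single 1 1 𝐜I))))
    (hcas : ∃ c : ℂ, ∀ v : archGardingSpace hcpt τ,
      ∑ i : Fin 2, ∑ j : Fin 2, (D (Matrix.single i j 𝐜) + s • D (Matrix.single i j 𝐜I))
        ((D (Matrix.single j i 𝐜) + s • D (Matrix.single j i 𝐜I)) v) = c • v)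
    (hchar : ∀ u : (mixedSpace K)ˣ, archWhittakerDChar K (0 : Fin 2) 1 ((u : mixedSpace K) * 𝐜) +
        s * archWhittakerDChar K (0 : Fin 2) 1 ((u : mixedSpace K) * 𝐜I) ≠ 0)
    {v : archGardingSpace hcpt τ} (hv : v ∈ kirillovNull hτ ℓ) :
    (D (Matrix.single 1 0 𝐜) + s • D (Matrix.single 1 0 𝐜I)) v ∈ kirillovNull hτ ℓ := by
  obtain ⟨c, hc⟩ := hcas
  set T00 := D (Matrix.single 0 0 𝐜) + s • D (Matrix.single 0 0 𝐜I) with hT00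
  set T11 := D (Matrix.single 1 1 𝐜) + s • D (Matrix.single 1 1 𝐜I) with hT11
  set T01 := D (Matrix.single 0 1 𝐜) + s • D (Matrix.single 0 1 𝐜I) with hT01
  set T10 := D (Matrix.single 1 0 𝐜) + s • D (Matrix.single 1 0 𝐜I) with hT10
  have h := hc v
  rw [Fin.sum_univ_two, Fin.sum_univ_two, Fin.sum_univ_two] at h
  have hcomm' : T10 (T01 v) = T01 (T10 v) - (2 : ℂ) • (T00 v - T11 v) := by
    have h' := congrArg (fun T => T v) hcomm
    simp only [Module.End.mul_apply, LinearMap.sub_apply, LinearMap.smul_apply] at h'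
    rw [← h']; abel
  have h2 : (2 : ℂ) • T01 (T10 v) = c • v - T00 (T00 v) - T11 (T11 v) + (2 : ℂ) • (T00 v - T11 v) := by
    rw [two_smul, ← h, hcomm']; abel
  have h3 : T01 (T10 v) = (2 : ℂ)⁻¹ • (c • v - T00 (T00 v) - T11 (T11 v) + (2 : ℂ) • (T00 v - T11 v)) := by
    rw [← h2, smul_smul, inv_mul_cancel₀ (two_ne_zero' ℂ), one_smul]
  have h00 : ∀ y : archGardingSpace hcpt τ, y ∈ kirillovNull hτ ℓ → T00 y ∈ kirillovNull hτ ℓ :=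
    fun y hy => gardingEnd_sub_smul_mem_kirillovNull hτ w hℓW.norm_le hcen 0 s hy
  have h11 : ∀ y : archGardingSpace hcpt τ, y ∈ kirillovNull hτ ℓ → T11 y ∈ kirillovNull hτ ℓ :=
    fun y hy => gardingEnd_sub_smul_mem_kirillovNull hτ w hℓW.norm_le hcen 1 s hy
  have key : T01 (T10 v) ∈ kirillovNull hτ ℓ := by
    rw [h3]
    exact Submodule.smul_mem _ _ (Submodule.add_mem _ (Submodule.sub_mem _ (Submodule.sub_mem _
      (Submodule.smul_mem _ _ hv) (h00 _ (h00 _ hv))) (h11 _ (h11 _ hv)))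
      (Submodule.smul_mem _ _ (Submodule.sub_mem _ (h00 _ hv) (h11 _ hv))))
  intro u
  have hk := key u
  rw [kirillovFn_eq_apply_gardingAct, hT01, apply_gardingAct_diagGL2_gardingEnd_zero_one_add_smul hτ w hℓW] at hk
  rw [kirillovFn_eq_apply_gardingAct]
  exact (mul_eq_zero.1 hk).resolve_left (hchar u)

/-- **`τ^h(E₁₀)` preserves `S_ℓ`** (holomorphic Casimir). [cite: JacquetLanglands1970, §6 (Thm. 6.4)] -/
theorem gardingEndHol_one_zero_mem_kirillovNull (hℓW : IsArchContWhittakerFunctional hcpt τ hτ ℓ)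
    (hcen : ∀ x : mixedSpace K, ∃ d : ℂ, ∀ v : archGardingSpace hcpt τ, D (x • (1 : Matrix (Fin 2) (Fin 2) (mixedSpace K))) v = d • v)
    (hcas : ∃ c : ℂ, ∀ v : archGardingSpace hcpt τ, ∑ i : Fin 2, ∑ j : Fin 2, Dh[i,j] (Dh[j,i] v) = c • v)
    {v : archGardingSpace hcpt τ} (hv : v ∈ kirillovNull hτ ℓ) : Dh[1,0] v ∈ kirillovNull hτ ℓ := by
  have e : ∀ i j : Fin 2, Dh[i,j] = D (Matrix.single i j 𝐜) + (-Complex.I) • D (Matrix.single i j 𝐜I) := fun i j => by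
    module
  simp only [e] at hcas ⊢
  refine gardingEnd_one_zero_add_smul_mem_kirillovNull hτ w hℓW hcen (-Complex.I) ?_ hcas (fun u => ?_) hv
  · have h := gardingEndHol_xPlus_comm_xMinus hτ w
    simp only [e] at h
    exact h
  · rw [neg_mul, ← sub_eq_add_neg]
    exact (archWhittakerDChar_hol u w).2

/-- **`τ^a(E₁₀)` preserves `S_ℓ`** (antiholomorphic Casimir). [cite: JacquetLanglands1970, §6 (Thm. 6.4)] -/
theorem gardingEndAnti_one_zero_mem_kirillovNull (hℓW : IsArchContWhittakerFunctional hcpt τ hτ ℓ)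
    (hcen : ∀ x : mixedSpace K, ∃ d : ℂ, ∀ v : archGardingSpace hcpt τ, D (x • (1 : Matrix (Fin 2) (Fin 2) (mixedSpace K))) v = d • v)
    (hcas : ∃ c : ℂ, ∀ v : archGardingSpace hcpt τ, ∑ i : Fin 2, ∑ j : Fin 2, Da[i,j] (Da[j,i] v) = c • v)
    {v : archGardingSpace hcpt τ} (hv : v ∈ kirillovNull hτ ℓ) : Da[1,0] v ∈ kirillovNull hτ ℓ := by
  refine gardingEnd_one_zero_add_smul_mem_kirillovNull hτ w hℓW hcen Complex.I (gardingEndAnti_xPlus_comm_xMinus hτ w)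
    hcas (fun u => (archWhittakerDChar_anti u w).2) hv

/-- **`τ(E₁₀ ⊗ c_w)` and `τ(E₁₀ ⊗ ic_w)` preserve `S_ℓ`**: `τ(E₁₀ ⊗ c) = ½(τ^h + τ^a)(E₁₀)`,
`τ(E₁₀ ⊗ ic) = (2i)⁻¹(τ^a - τ^h)(E₁₀)`. [cite: JacquetLanglands1970, §6 (Thm. 6.4)] -/
theorem gardingEnd_one_zero_complex_mem_kirillovNull (hℓW : IsArchContWhittakerFunctional hcpt τ hτ ℓ)
    (hcen : ∀ x : mixedSpace K, ∃ d : ℂ, ∀ v : archGardingSpace hcpt τ, D (x • (1 : Matrix (Fin 2) (Fin 2) (mixedSpace K))) v = d • v)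
    (hcasH : ∃ c : ℂ, ∀ v : archGardingSpace hcpt τ, ∑ i : Fin 2, ∑ j : Fin 2, Dh[i,j] (Dh[j,i] v) = c • v)
    (hcasA : ∃ c : ℂ, ∀ v : archGardingSpace hcpt τ, ∑ i : Fin 2, ∑ j : Fin 2, Da[i,j] (Da[j,i] v) = c • v)
    {v : archGardingSpace hcpt τ} (hv : v ∈ kirillovNull hτ ℓ) :
    D (Matrix.single 1 0 𝐜) v ∈ kirillovNull hτ ℓ ∧ D (Matrix.single 1 0 𝐜I) v ∈ kirillovNull hτ ℓ := by
  have hh := gardingEndHol_one_zero_mem_kirillovNull hτ w hℓW hcen hcasH hv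
  have ha := gardingEndAnti_one_zero_mem_kirillovNull hτ w hℓW hcen hcasA hv
  rw [LinearMap.sub_apply, LinearMap.smul_apply] at hh
  rw [LinearMap.add_apply, LinearMap.smul_apply] at ha
  have e1 : D (Matrix.single 1 0 𝐜) v = (2 : ℂ)⁻¹ • ((D (Matrix.single 1 0 𝐜) v - Complex.I • D (Matrix.single 1 0 𝐜I) v) +
      (D (Matrix.single 1 0 𝐜) v + Complex.I • D (Matrix.single 1 0 𝐜I) v)) := by
    rw [sub_add_add_cancel, ← two_smul ℂ, smul_smul, inv_mul_cancel₀ (two_ne_zero' ℂ), one_smul]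
  have e2 : D (Matrix.single 1 0 𝐜I) v = (2 * Complex.I)⁻¹ • ((D (Matrix.single 1 0 𝐜) v + Complex.I • D (Matrix.single 1 0 𝐜I) v) -
      (D (Matrix.single 1 0 𝐜) v - Complex.I • D (Matrix.single 1 0 𝐜I) v)) := by
    rw [add_sub_sub_cancel, ← two_smul ℂ, smul_smul, smul_smul, mul_assoc, inv_mul_cancel₀ (mul_ne_zero (two_ne_zero' ℂ)
      Complex.I_ne_zero), one_smul]
  refine ⟨?_, ?_⟩
  · rw [e1]; exact Submodule.smul_mem _ _ (Submodule.add_mem _ hh ha)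
  · rw [e2]; exact Submodule.smul_mem _ _ (Submodule.sub_mem _ ha hh)

end Casimir

/-! ### 5. Stability under every `τ(X)` -/

section All

variable {hcpt : isCompact_glFiniteIntegralLevel 2 K}
  {E : Type*} [NormedAddCommGroup E] [NormedSpace ℂ E] [CompleteSpace E]
  {τ : ContRepresentation ℂ (AutomorphyDatum.gl 2 K hcpt).arch.carrier E}
  (hτ : τ.IsStronglyContinuous) {ℓ : archGardingSpace hcpt τ →ₗ[ℂ] ℂ}

local notation "D" => gardingEnd (hcpt := hcpt) (τ := τ) hτ

/-- **`τ(E₁₀ ⊗ x)` preserves `S_ℓ`** for every `x ∈ K_∞` (expand `x` in the place idempotents).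
[cite: JacquetLanglands1970, §5–§6] -/
theorem gardingEnd_single_one_zero_mem_kirillovNull (hℓW : IsArchContWhittakerFunctional hcpt τ hτ ℓ)
    (hcen : ∀ x : mixedSpace K, ∃ d : ℂ, ∀ v : archGardingSpace hcpt τ, D (x • (1 : Matrix (Fin 2) (Fin 2) (mixedSpace K))) v = d • v)
    (hcasR : ∀ w : {w : InfinitePlace K // IsReal w}, ∃ c : ℂ, ∀ v : archGardingSpace hcpt τ,
      ∑ i : Fin 2, ∑ j : Fin 2, D (Matrix.single i j ((Pi.single w 1, 0) : mixedSpace K))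
        (D (Matrix.single j i ((Pi.single w 1, 0) : mixedSpace K)) v) = c • v)
    (hcasH : ∀ w : {w : InfinitePlace K // IsComplex w}, ∃ c : ℂ, ∀ v : archGardingSpace hcpt τ,
      ∑ i : Fin 2, ∑ j : Fin 2,
        (D (Matrix.single i j ((0, Pi.single w 1) : mixedSpace K)) - Complex.I • D (Matrix.single i j ((0, Pi.single w Complex.I) : mixedSpace K)))
          ((D (Matrix.single j i ((0, Pi.single w 1) : mixedSpace K)) - Complex.I • D (Matrix.single j i ((0, Pi.single w Complex.I) : mixedSpace K))) v) =
        c • v)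
    (hcasA : ∀ w : {w : InfinitePlace K // IsComplex w}, ∃ c : ℂ, ∀ v : archGardingSpace hcpt τ,
      ∑ i : Fin 2, ∑ j : Fin 2,
        (D (Matrix.single i j ((0, Pi.single w 1) : mixedSpace K)) + Complex.I • D (Matrix.single i j ((0, Pi.single w Complex.I) : mixedSpace K)))
          ((D (Matrix.single j i ((0, Pi.single w 1) : mixedSpace K)) + Complex.I • D (Matrix.single j i ((0, Pi.single w Complex.I) : mixedSpace K))) v) =
        c • v)
    (x : mixedSpace K) {v : archGardingSpace hcpt τ} (hv : v ∈ kirillovNull hτ ℓ) :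
    D (Matrix.single 1 0 x) v ∈ kirillovNull hτ ℓ := by
  have hx : Matrix.single (1 : Fin 2) (0 : Fin 2) x =
      ∑ w : {w : InfinitePlace K // IsReal w}, x.1 w • Matrix.single (1 : Fin 2) (0 : Fin 2) ((Pi.single w 1, 0) : mixedSpace K) +
        ∑ w : {w : InfinitePlace K // IsComplex w},
          ((x.2 w).re • Matrix.single (1 : Fin 2) (0 : Fin 2) ((0, Pi.single w 1) : mixedSpace K) +
            (x.2 w).im • Matrix.single (1 : Fin 2) (0 : Fin 2) ((0, Pi.single w Complex.I) : mixedSpace K)) := by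
    have e : ∀ y : mixedSpace K, Matrix.single (1 : Fin 2) (0 : Fin 2) y = Matrix.singleLinearMap ℝ (1 : Fin 2) (0 : Fin 2) y :=
      fun y => rfl
    conv_lhs => rw [e, mixedSpace_eq_sum x]
    simp only [map_add, _root_.map_sum, map_smul]
    rfl
  rw [hx, gardingEnd_add, gardingEnd_sum_smul, gardingEnd_sum, LinearMap.add_apply, LinearMap.sum_apply,
    LinearMap.sum_apply]
  refine Submodule.add_mem _ (Submodule.sum_mem _ fun w _ => ?_) (Submodule.sum_mem _ fun w _ => ?_)
  · rw [LinearMap.smul_apply]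
    exact Submodule.smul_mem _ _ (gardingEnd_xMinus_mem_kirillovNull hτ hℓW w hcen (hcasR w) hv)
  · obtain ⟨h1, h2⟩ := gardingEnd_one_zero_complex_mem_kirillovNull hτ w hℓW hcen (hcasH w) (hcasA w) hv
    rw [gardingEnd_add, gardingEnd_smul, gardingEnd_smul, LinearMap.add_apply, LinearMap.smul_apply, LinearMap.smul_apply]
    exact Submodule.add_mem _ (Submodule.smul_mem _ _ h1) (Submodule.smul_mem _ _ h2)

/-- **`S_ℓ` is a `U(𝔤)`-submodule**: every `τ(X)`, `X ∈ 𝔤𝔩₂(K_∞)`, preserves it, provided the centre of `𝔤`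
and the Casimir elements (real places) / holomorphic and antiholomorphic Casimir elements (complex places) act
on the Gårding space by scalars. [cite: JacquetLanglands1970, §5 (Lemma 5.13.1), §6 (Thm. 6.4)] -/
theorem gardingEnd_mem_kirillovNull (hℓW : IsArchContWhittakerFunctional hcpt τ hτ ℓ)
    (hcen : ∀ x : mixedSpace K, ∃ d : ℂ, ∀ v : archGardingSpace hcpt τ, D (x • (1 : Matrix (Fin 2) (Fin 2) (mixedSpace K))) v = d • v)
    (hcasR : ∀ w : {w : InfinitePlace K // IsReal w}, ∃ c : ℂ, ∀ v : archGardingSpace hcpt τ,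
      ∑ i : Fin 2, ∑ j : Fin 2, D (Matrix.single i j ((Pi.single w 1, 0) : mixedSpace K))
        (D (Matrix.single j i ((Pi.single w 1, 0) : mixedSpace K)) v) = c • v)
    (hcasH : ∀ w : {w : InfinitePlace K // IsComplex w}, ∃ c : ℂ, ∀ v : archGardingSpace hcpt τ,
      ∑ i : Fin 2, ∑ j : Fin 2,
        (D (Matrix.single i j ((0, Pi.single w 1) : mixedSpace K)) - Complex.I • D (Matrix.single i j ((0, Pi.single w Complex.I) : mixedSpace K)))
          ((D (Matrix.single j i ((0, Pi.single w 1) : mixedSpace K)) - Complex.I • D (Matrix.single j i ((0, Pi.single w Complex.I) : mixedSpace K))) v) =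
        c • v)
    (hcasA : ∀ w : {w : InfinitePlace K // IsComplex w}, ∃ c : ℂ, ∀ v : archGardingSpace hcpt τ,
      ∑ i : Fin 2, ∑ j : Fin 2,
        (D (Matrix.single i j ((0, Pi.single w 1) : mixedSpace K)) + Complex.I • D (Matrix.single i j ((0, Pi.single w Complex.I) : mixedSpace K)))
          ((D (Matrix.single j i ((0, Pi.single w 1) : mixedSpace K)) + Complex.I • D (Matrix.single j i ((0, Pi.single w Complex.I) : mixedSpace K))) v) =
        c • v)
    (X : Matrix (Fin 2) (Fin 2) (mixedSpace K)) {v : archGardingSpace hcpt τ} (hv : v ∈ kirillovNull hτ ℓ) :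
    D X v ∈ kirillovNull hτ ℓ := by
  rw [Matrix.matrix_eq_sum_single X, gardingEnd_sum, LinearMap.sum_apply]
  refine Submodule.sum_mem _ fun i _ => ?_
  rw [gardingEnd_sum, LinearMap.sum_apply]
  refine Submodule.sum_mem _ fun j _ => ?_
  fin_cases i <;> fin_cases j
  · exact gardingEnd_single_zero_zero_mem_kirillovNull hτ hℓW.norm_le _ hv
  · exact gardingEnd_single_zero_one_mem_kirillovNull hτ hℓW _ hv
  · exact gardingEnd_single_one_zero_mem_kirillovNull hτ hℓW hcen hcasR hcasH hcasA _ hv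
  · exact gardingEnd_single_one_one_mem_kirillovNull hτ hℓW.norm_le _ (hcen _) hv

/-- Products of the `τ(X_i)` (monomials of `U(𝔤)`) preserve `S_ℓ`. [cite: JacquetLanglands1970, §5–§6] -/
theorem prod_map_gardingEnd_mem_kirillovNull (hℓW : IsArchContWhittakerFunctional hcpt τ hτ ℓ)
    (hcen : ∀ x : mixedSpace K, ∃ d : ℂ, ∀ v : archGardingSpace hcpt τ, D (x • (1 : Matrix (Fin 2) (Fin 2) (mixedSpace K))) v = d • v)
    (hcasR : ∀ w : {w : InfinitePlace K // IsReal w}, ∃ c : ℂ, ∀ v : archGardingSpace hcpt τ,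
      ∑ i : Fin 2, ∑ j : Fin 2, D (Matrix.single i j ((Pi.single w 1, 0) : mixedSpace K))
        (D (Matrix.single j i ((Pi.single w 1, 0) : mixedSpace K)) v) = c • v)
    (hcasH : ∀ w : {w : InfinitePlace K // IsComplex w}, ∃ c : ℂ, ∀ v : archGardingSpace hcpt τ,
      ∑ i : Fin 2, ∑ j : Fin 2,
        (D (Matrix.single i j ((0, Pi.single w 1) : mixedSpace K)) - Complex.I • D (Matrix.single i j ((0, Pi.single w Complex.I) : mixedSpace K)))
          ((D (Matrix.single j i ((0, Pi.single w 1) : mixedSpace K)) - Complex.I • D (Matrix.single j i ((0, Pi.single w Complex.I) : mixedSpace K))) v) =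
        c • v)
    (hcasA : ∀ w : {w : InfinitePlace K // IsComplex w}, ∃ c : ℂ, ∀ v : archGardingSpace hcpt τ,
      ∑ i : Fin 2, ∑ j : Fin 2,
        (D (Matrix.single i j ((0, Pi.single w 1) : mixedSpace K)) + Complex.I • D (Matrix.single i j ((0, Pi.single w Complex.I) : mixedSpace K)))
          ((D (Matrix.single j i ((0, Pi.single w 1) : mixedSpace K)) + Complex.I • D (Matrix.single j i ((0, Pi.single w Complex.I) : mixedSpace K))) v) =
        c • v) :
    ∀ (ws : List (Matrix (Fin 2) (Fin 2) (mixedSpace K))) {v : archGardingSpace hcpt τ}, v ∈ kirillovNull hτ ℓ →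
      (ws.map (gardingEnd hτ)).prod v ∈ kirillovNull hτ ℓ
  | [], _, hv => by simpa using hv
  | X :: ws, _, hv => by
    rw [List.map_cons, List.prod_cons, Module.End.mul_apply]
    exact gardingEnd_mem_kirillovNull hτ hℓW hcen hcasR hcasH hcasA X
      (prod_map_gardingEnd_mem_kirillovNull hℓW hcen hcasR hcasH hcasA ws hv)

end All

/-! ### 6. The unitary irreducible case -/

section Unitary

variable {hcpt : isCompact_glFiniteIntegralLevel 2 K}
  {E : Type*} [NormedAddCommGroup E] [InnerProductSpace ℂ E] [CompleteSpace E]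
  {τ : ContRepresentation ℂ (AutomorphyDatum.gl 2 K hcpt).arch.carrier E}
  (hτ : τ.IsStronglyContinuous)

local notation "D" => gardingEnd (hcpt := hcpt) (τ := τ) hτ

/-- For `τ` unitary and topologically irreducible the centre `K_∞ · 1 ⊆ 𝔤` acts on `𝒢` by scalars
(`ArchGardingSegal.exists_archDerivE_scalar_eq_smul`, in `End(𝒢)`-form). [cite: Knapp1986, Ch. VIII §3] -/
theorem exists_gardingEnd_smul_one_eq_smul (hτu : τ.IsUnitary) (hτi : τ.IsTopIrreducible) (x : mixedSpace K) :
    ∃ d : ℂ, ∀ v : archGardingSpace hcpt τ, D (x • (1 : Matrix (Fin 2) (Fin 2) (mixedSpace K))) v = d • v := by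
  obtain ⟨d, hd⟩ := exists_archDerivE_scalar_eq_smul (hcpt := hcpt) (τ := τ) hτ hτu hτi x
  exact ⟨d, fun v => Subtype.ext (by rw [coe_gardingEnd_apply, hd _ v.2, Submodule.coe_smul])⟩

/-- The Casimir element of a real place acts on `𝒢` by a scalar (`End(𝒢)`-form of
`exists_placeCasimirReal_eq_smul`). [cite: Knapp1986, Ch. VIII §3] -/
theorem exists_placeCasimirReal_gardingEnd_eq_smul (hτu : τ.IsUnitary) (hτi : τ.IsTopIrreducible)
    (w : {w : InfinitePlace K // IsReal w}) :
    ∃ c : ℂ, ∀ v : archGardingSpace hcpt τ,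
      ∑ i : Fin 2, ∑ j : Fin 2, D (Matrix.single i j ((Pi.single w 1, 0) : mixedSpace K))
        (D (Matrix.single j i ((Pi.single w 1, 0) : mixedSpace K)) v) = c • v := by
  obtain ⟨c, hc⟩ := exists_placeCasimirReal_eq_smul (hcpt := hcpt) (τ := τ) hτ hτu hτi w
  refine ⟨c, fun v => Subtype.ext ?_⟩
  rw [Submodule.coe_sum, Submodule.coe_smul, ← hc _ v.2]
  refine Finset.sum_congr rfl fun i _ => ?_
  rw [Submodule.coe_sum]
  rfl

/-- The holomorphic and antiholomorphic Casimir elements of a complex place act on `𝒢` by scalars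
(`End(𝒢)`-form). [cite: Knapp1986, Ch. VIII §3] -/
theorem exists_placeCasimirHolAnti_gardingEnd_eq_smul (hτu : τ.IsUnitary) (hτi : τ.IsTopIrreducible)
    (w : {w : InfinitePlace K // IsComplex w}) :
    (∃ c : ℂ, ∀ v : archGardingSpace hcpt τ,
      ∑ i : Fin 2, ∑ j : Fin 2,
        (D (Matrix.single i j ((0, Pi.single w 1) : mixedSpace K)) - Complex.I • D (Matrix.single i j ((0, Pi.single w Complex.I) : mixedSpace K)))
          ((D (Matrix.single j i ((0, Pi.single w 1) : mixedSpace K)) - Complex.I • D (Matrix.single j i ((0, Pi.single w Complex.I) : mixedSpace K))) v) =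
        c • v) ∧
    (∃ c : ℂ, ∀ v : archGardingSpace hcpt τ,
      ∑ i : Fin 2, ∑ j : Fin 2,
        (D (Matrix.single i j ((0, Pi.single w 1) : mixedSpace K)) + Complex.I • D (Matrix.single i j ((0, Pi.single w Complex.I) : mixedSpace K)))
          ((D (Matrix.single j i ((0, Pi.single w 1) : mixedSpace K)) + Complex.I • D (Matrix.single j i ((0, Pi.single w Complex.I) : mixedSpace K))) v) =
        c • v) := by
  refine ⟨?_, ?_⟩
  · obtain ⟨c, hc⟩ := exists_placeCasimirHol_eq_smul (hcpt := hcpt) (τ := τ) hτ hτu hτi w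
    refine ⟨c, fun v => Subtype.ext ?_⟩
    rw [coe_placeCasimirHol_apply, Submodule.coe_smul]
    exact hc _ v.2
  · obtain ⟨c, hc⟩ := exists_placeCasimirAnti_eq_smul (hcpt := hcpt) (τ := τ) hτ hτu hτi w
    refine ⟨c, fun v => Subtype.ext ?_⟩
    rw [coe_placeCasimirAnti_apply, Submodule.coe_smul]
    exact hc _ v.2

/-- **For an irreducible unitary `τ` and a continuous `ψ_∞`-Whittaker functional `ℓ`, the null space `S_ℓ` of
the Kirillov map is stable under every `τ(X)`, `X ∈ 𝔤𝔩₂(K_∞)`** (Jacquet–Langlands (1970), §5–§6).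
[cite: JacquetLanglands1970, §5 (Lemma 5.13.1), §6 (Thm. 6.4)] -/
theorem gardingEnd_mem_kirillovNull_of_isUnitary (hτu : τ.IsUnitary) (hτi : τ.IsTopIrreducible)
    {ℓ : archGardingSpace hcpt τ →ₗ[ℂ] ℂ} (hℓW : IsArchContWhittakerFunctional hcpt τ hτ ℓ)
    (X : Matrix (Fin 2) (Fin 2) (mixedSpace K)) {v : archGardingSpace hcpt τ} (hv : v ∈ kirillovNull hτ ℓ) :
    D X v ∈ kirillovNull hτ ℓ :=
  gardingEnd_mem_kirillovNull hτ hℓW (exists_gardingEnd_smul_one_eq_smul hτ hτu hτi)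
    (exists_placeCasimirReal_gardingEnd_eq_smul hτ hτu hτi)
    (fun w => (exists_placeCasimirHolAnti_gardingEnd_eq_smul hτ hτu hτi w).1)
    (fun w => (exists_placeCasimirHolAnti_gardingEnd_eq_smul hτ hτu hτi w).2) X hv

/-- The same for monomials of `U(𝔤)`. [cite: JacquetLanglands1970, §5–§6] -/
theorem prod_map_gardingEnd_mem_kirillovNull_of_isUnitary (hτu : τ.IsUnitary) (hτi : τ.IsTopIrreducible)
    {ℓ : archGardingSpace hcpt τ →ₗ[ℂ] ℂ} (hℓW : IsArchContWhittakerFunctional hcpt τ hτ ℓ)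
    (ws : List (Matrix (Fin 2) (Fin 2) (mixedSpace K))) {v : archGardingSpace hcpt τ} (hv : v ∈ kirillovNull hτ ℓ) :
    (ws.map (gardingEnd hτ)).prod v ∈ kirillovNull hτ ℓ :=
  prod_map_gardingEnd_mem_kirillovNull hτ hℓW (exists_gardingEnd_smul_one_eq_smul hτ hτu hτi)
    (exists_placeCasimirReal_gardingEnd_eq_smul hτ hτu hτi)
    (fun w => (exists_placeCasimirHolAnti_gardingEnd_eq_smul hτ hτu hτi w).1)
    (fun w => (exists_placeCasimirHolAnti_gardingEnd_eq_smul hτ hτu hτi w).2) ws hv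

end Unitary

end Literature.NumberTheory.Automorphic
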